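import Mathlib
import HarnessLib
import Summits.HubbardSuperconductivity.HubbardSuperconductivity.Theorems.KLProgrammeH10TwoPointLimitAnchoredSectorCountThinExplicit
import Summits.HubbardSuperconductivity.HubbardSuperconductivity.Theorems.KLProgrammeH10TwoPointLimitKlAnisoAnchoredSectorCountThin

/-!
# Route `KLProgramme` — the log-free anchored anisotropic sector count `#{Ω ∈ bgmSectorSet … (klAnisoFamily … K klE0 n) 4 : Ω p = s} ≤ C·sectorCount n`
# with EXPLICIT regime doors `c₃(B, R)`, `U₀(B, R)` (cure (γ) of located #15 «(X).1-C-DOOR-SLOT», step 2d; cell gate-hubbard-kl, seat p3 g25)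

Twin of `card_bgmSectorSet_klAniso_anchored_le_linear` (`…KlAnisoAnchoredSectorCountThin`, whose helper lemmas it reuses) fed with
`anchoredSectorCount_thin_frameOK_explicit` at `c_T = klE0/π²`: for ANY bundle `B : BandBounds ((μ₁−4)/2) (μ₂/2)` the count holds for every `R` with the
CLOSED-FORM doors `c₃ = κ_frame(B)/(12(Gfr₂+1))`, `U₀ = min 1 (κ_frame(B)/(24(Gfr₀+Gfr₁+1)))`, `κ_frame` as in `…AnchoredSectorCountThinExplicit`.
What remains for the door row `klEngC₃6 P R ≤ c₃(B, R)` of located #15 is a NUMERIC lower bound on `κ_frame(B)` at the covariance window (step 3) and the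
re-key of (T3)'s chain on these doors (step 4).

* **`card_bgmSectorSet_klAniso_anchored_le_linear_explicit`**.
Everything is PROVED; no definitions; nothing about the Hubbard model is asserted.  References: BGM 2006 §2.8 (2.73), (2.76)–(2.80), Lemma 3.1, App. A3
[cite: BenfattoGiulianiMastropietro2006]; Mastropietro 2008 (14.67) [cite: Mastropietro2008].
-/

noncomputable section

namespace Summit.HubbardSuperconductivity.HubbardSuperconductivity.Theorems.PerturbedFermiCurve

set_option linter.dupNamespace false -- summit = problem name (single-conjunct summit), D-0017

open Classical
open Real Set Finset
open Literature.MathematicalPhysics.QuantumLattice Literature.MathematicalPhysics.QuantumLattice.BandSectorCounting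
open Literature.Probability.LatticeModels
open Summit.HubbardSuperconductivity.HubbardSuperconductivity.Theorems.DispersionFlow
open Summit.HubbardSuperconductivity.HubbardSuperconductivity.Theorems.KLRegimeSplit
open Summit.HubbardSuperconductivity.HubbardSuperconductivity.Theorems.KLProgrammeLegKernels

set_option maxHeartbeats 1600000 in
/-- **The log-free anchored anisotropic sector count with EXPLICIT regime doors, any bundle `B`** (twin of `card_bgmSectorSet_klAniso_anchored_le_linear`).
[cite: BenfattoGiulianiMastropietro2006, §2.8 (2.73), (2.76)–(2.80), Lemma 3.1, App. A3] -/
theorem card_bgmSectorSet_klAniso_anchored_le_linear_explicit {μ₁ μ₂ : ℝ} (hμ₁ : -4 < μ₁) (h12 : μ₁ ≤ μ₂) (hμ₂ : μ₂ < 0)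
    (B : BandBounds ((μ₁ - 4) / 2) (μ₂ / 2)) :
    ∃ C : ℝ, 0 < C ∧ ∀ R : RenConsts, (∀ j, 0 ≤ R.Gfr j) →
      ∃ c₃ : ℝ, c₃ = (min (min (pcThinKappa B (min (μ₁ - (μ₁ - 4) / 2) (μ₂ / 2 - μ₂) / 2)) (min 1 (min (B.Dtmin / 2) (min (μ₁ - (μ₁ - 4) / 2) (μ₂ / 2 - μ₂) / 4)))) (min (μ₁ - (μ₁ - 4) / 2) (μ₂ / 2 - μ₂))) / (12 * (R.Gfr 2 + 1)) ∧ 0 < c₃ ∧ ∃ U₀ : ℝ, U₀ = min 1 ((min (min (pcThinKappa B (min (μ₁ - (μ₁ - 4) / 2) (μ₂ / 2 - μ₂) / 2)) (min 1 (min (B.Dtmin / 2) (min (μ₁ - (μ₁ - 4) / 2) (μ₂ / 2 - μ₂) / 4)))) (min (μ₁ - (μ₁ - 4) / 2) (μ₂ / 2 - μ₂))) / (24 * (R.Gfr 0 + R.Gfr 1 + 1))) ∧ 0 < U₀ ∧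
      ∀ c : ℝ, 0 < c → c ≤ c₃ → ∀ U : ℝ, 0 < U → U ≤ U₀ → ∀ β : ℝ, klBetaMin ≤ β → β ≤ Real.exp (c / U ^ 2) →
      ∀ μ ∈ Set.Icc μ₁ μ₂, ∀ (ν : ℝ) (K : TrigPolyC4v), FrameOK R U (nScales β) ν K →
      ∀ (L M : ℕ) [NeZero L] (n : ℕ) (p : Fin 4) (s : SectorLeg (sectorCount n)),
      ((((bgmSectorSet L M (klAnisoFamily L M β μ K klE0 n) 4).filter
          (fun Ω : Fin 4 → SectorLeg (sectorCount n) => Ω p = s)).card : ℕ) : ℝ) ≤ C * sectorCount n := by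
  have he0 : (0 : ℝ) < klE0 := by norm_num [klE0]
  obtain ⟨Kc, hKc, hKR⟩ := anchoredSectorCount_thin_frameOK_explicit hμ₁ h12 hμ₂ B (cT := klE0 / π ^ 2) (by positivity)
  refine ⟨32400 * 64 * Kc, by positivity, fun R hR => ?_⟩
  obtain ⟨c₃, hc₃eq, hc₃, U₀, hU₀eq, hU₀, hcount⟩ := hKR R hR
  refine ⟨c₃, hc₃eq, hc₃, U₀, hU₀eq, hU₀, ?_⟩
  intro c hc hcle U hU hUle β hβmin hβc μ hμ ν K hK L M _ n p s
  have hC := hcount c hc hcle U hU hUle β hβmin hβc μ hμ ν K hK n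
  have hNpos : 0 < sectorCount n := sectorCount_pos n
  -- the transposition `(0 p)` of the legs
  obtain ⟨τ, hτdef⟩ : ∃ τ : Equiv.Perm (Fin 4), τ = Equiv.swap 0 p := ⟨_, rfl⟩
  have hτ0 : τ 0 = p := by rw [hτdef]; exact Equiv.swap_apply_left 0 p
  have hττ : ∀ i, τ (τ i) = i := fun i => by rw [hτdef]; exact Equiv.swap_apply_self 0 p i
  -- the six candidate sharp indices of a label: `(ω + e·2ⁿ + d + N − 1) mod N`, `(e, d) ∈ Fin 2 × Fin 3`
  obtain ⟨sh, hshdef⟩ : ∃ sh : Fin 2 × Fin 3 → SectorLeg (sectorCount n) → Fin (sectorCount n),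
      ∀ ed lam, (sh ed lam : ℕ) = ((lam.1.1 : ℕ) + (ed.1 : ℕ) * 2 ^ n + (ed.2 : ℕ) + (sectorCount n - 1)) % sectorCount n :=
    ⟨fun ed lam => ⟨((lam.1.1 : ℕ) + (ed.1 : ℕ) * 2 ^ n + (ed.2 : ℕ) + (sectorCount n - 1)) % sectorCount n,
      Nat.mod_lt _ hNpos⟩, fun _ _ => rfl⟩
  have hsh_inj : ∀ (ed : Fin 2 × Fin 3) (lam lam' : SectorLeg (sectorCount n)), sh ed lam = sh ed lam' →
      lam.1.2 = lam'.1.2 → lam.2 = lam'.2 → lam = lam' := by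
    intro ed lam lam' h1 h2 h3
    have h1' : ((lam.1.1 : ℕ) + ((ed.1 : ℕ) * 2 ^ n + (ed.2 : ℕ) + (sectorCount n - 1))) % sectorCount n =
        ((lam'.1.1 : ℕ) + ((ed.1 : ℕ) * 2 ^ n + (ed.2 : ℕ) + (sectorCount n - 1))) % sectorCount n := by
      have := congrArg Fin.val h1
      rw [hshdef, hshdef] at this
      simpa only [add_assoc] using this
    have hmod : (lam.1.1 : ℕ) ≡ (lam'.1.1 : ℕ) [MOD sectorCount n] := Nat.ModEq.add_right_cancel' _ h1'
    have heq : (lam.1.1 : ℕ) = (lam'.1.1 : ℕ) := Nat.ModEq.eq_of_lt_of_lt hmod lam.1.1.isLt lam'.1.1.isLt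
    exact Prod.ext (Prod.ext (Fin.ext heq) h2) h3
  -- the admissible sharp triples of the frame count (anchor index `ω₁`, reciprocal vector `G`)
  obtain ⟨Adm, hAdmdef⟩ : ∃ Adm : Fin (sectorCount n) → (Fin 2 → ℤ) →
      Finset (Fin (sectorCount n) × Fin (sectorCount n) × Fin (sectorCount n)), ∀ ω₁ G, Adm ω₁ G =
    (Finset.univ : Finset (Fin (sectorCount n) × Fin (sectorCount n) × Fin (sectorCount n))).filter
      (fun ω : Fin (sectorCount n) × Fin (sectorCount n) × Fin (sectorCount n) =>
      ∃ k : Fin 4 → Fin 2 → ℝ, (∀ j i, |k j i| ≤ Real.pi) ∧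
        (∀ j, |frameLevel μ K (WithLp.toLp 2 (k j))| ≤ klE0 / π ^ 2 * sectorWidth n ^ 2) ∧
        sectorIndex n (Complex.arg (⟨k 0 0, k 0 1⟩ : ℂ)) = (ω₁ : ℕ) ∧
        sectorIndex n (Complex.arg (⟨k 1 0, k 1 1⟩ : ℂ)) = (ω.1 : ℕ) ∧
        sectorIndex n (Complex.arg (⟨k 2 0, k 2 1⟩ : ℂ)) = (ω.2.1 : ℕ) ∧
        sectorIndex n (Complex.arg (⟨k 3 0, k 3 1⟩ : ℂ)) = (ω.2.2 : ℕ) ∧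
        (∀ i, ∑ j, k j i = 2 * Real.pi * (G i : ℝ))) := ⟨_, fun _ _ => rfl⟩
  have hAdm : ∀ ω₁ G, ((Adm ω₁ G).card : ℝ) ≤ Kc * 2 ^ n := fun ω₁ G => by rw [hAdmdef]; exact hC G ω₁
  -- reciprocal vectors `|G_j| ≤ 2`, parametrised by `Fin 5 × Fin 5`
  obtain ⟨Gof, hGofdef⟩ : ∃ Gof : Fin 5 × Fin 5 → Fin 2 → ℤ, ∀ g i,
      Gof g i = if i = 0 then ((g.1 : ℕ) : ℤ) - 2 else ((g.2 : ℕ) : ℤ) - 2 := ⟨fun g i => _, fun _ _ => rfl⟩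
  -- the pieces
  obtain ⟨S, hSdef⟩ : ∃ S : (Fin 4 → Fin 2 × Fin 3) × (Fin 5 × Fin 5) → Finset (Fin 4 → SectorLeg (sectorCount n)),
      ∀ par, S par = (Finset.univ : Finset (Fin 4 → SectorLeg (sectorCount n))).filter
        (fun Ω : Fin 4 → SectorLeg (sectorCount n) => Ω p = s ∧
        (sh (par.1 (τ 1)) (Ω (τ 1)), sh (par.1 (τ 2)) (Ω (τ 2)), sh (par.1 (τ 3)) (Ω (τ 3))) ∈
          Adm (sh (par.1 p) s) (Gof par.2)) := ⟨_, fun _ => rfl⟩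
  -- (1) COVER: every admissible `Ω` lies in a piece
  have hcover : (bgmSectorSet L M (klAnisoFamily L M β μ K klE0 n) 4).filter
      (fun Ω : Fin 4 → SectorLeg (sectorCount n) => Ω p = s) ⊆ Finset.univ.biUnion S := by
    intro Ω hΩ
    simp only [Finset.mem_biUnion, Finset.mem_univ, true_and]
    rw [Finset.mem_filter, mem_bgmSectorSet] at hΩ
    have hΩp : Ω p = s := hΩ.2
    obtain ⟨kf, hkF, hsum⟩ := hΩ.1
    -- signed centred momenta of the legs
    obtain ⟨q, hqdef⟩ : ∃ q : Fin 4 → Fin 2 → ℝ, ∀ i j, q i j =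
        if (Ω i).2 = 0 then torusCentredMomentum L (kf i).2 j else -torusCentredMomentum L (kf i).2 j :=
      ⟨_, fun _ _ => rfl⟩
    have hqfun : ∀ i, q i = fun j =>
        if (Ω i).2 = 0 then torusCentredMomentum L (kf i).2 j else -torusCentredMomentum L (kf i).2 j :=
      fun i => funext (hqdef i)
    have hqabs : ∀ i j, |q i j| ≤ π := fun i j => by
      rw [hqdef]; exact abs_signed_torusCentredMomentum_le_pi L (Ω i).2 (kf i).2 j
    have hqlev : ∀ i, |frameLevel μ K (WithLp.toLp 2 (q i))| ≤ klE0 / π ^ 2 * sectorWidth n ^ 2 := fun i => by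
      rw [hqfun]; exact leg_thin_shell L M (hkF i) (Ω i).2
    have hqidx : ∀ i, ∃ ed : Fin 2 × Fin 3, sectorIndex n (Complex.arg (⟨q i 0, q i 1⟩ : ℂ)) = (sh ed (Ω i) : ℕ) := by
      intro i
      obtain ⟨e, d, hed⟩ := leg_sharp_index L M (hkF i) (Ω i).2
      refine ⟨(e, d), ?_⟩
      rw [hshdef, hqdef, hqdef]
      exact hed
    choose ed hed using hqidx
    obtain ⟨G, hG⟩ := exists_sum_signed_torusCentredMomentum_eq L (fun i => (Ω i).2) (fun i => (kf i).2) hsum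
    have hGq : ∀ j, ∑ i, q i j = 2 * π * (G j : ℝ) := fun j => by
      rw [← hG j]
      exact Finset.sum_congr rfl fun i _ => hqdef i j
    have hGabs : ∀ j, |G j| ≤ 2 := abs_le_two_of_sum_eq hqabs hGq
    have hG0 := hGabs 0
    have hG1 := hGabs 1
    rw [abs_le] at hG0 hG1
    -- the parameters of the piece
    obtain ⟨g, hg⟩ : ∃ g : Fin 5 × Fin 5, Gof g = G := by
      refine ⟨(⟨(G 0 + 2).toNat, by omega⟩, ⟨(G 1 + 2).toNat, by omega⟩), funext fun i => ?_⟩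
      have e0 : (((G 0 + 2).toNat : ℕ) : ℤ) = G 0 + 2 := Int.toNat_of_nonneg (by omega)
      have e1 : (((G 1 + 2).toNat : ℕ) : ℤ) = G 1 + 2 := Int.toNat_of_nonneg (by omega)
      rw [hGofdef]
      split_ifs with hi
      · rw [hi]
        simp only [e0]
        ring
      · have hi1 : i = 1 := by fin_cases i <;> first | rfl | exact absurd rfl hi
        rw [hi1]
        simp only [e1]
        ring
    refine ⟨(ed, g), ?_⟩
    rw [hSdef, Finset.mem_filter]
    refine ⟨Finset.mem_univ _, hΩp, ?_⟩
    rw [hg, hAdmdef, Finset.mem_filter]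
    refine ⟨Finset.mem_univ _, fun j => q (τ j), fun j i => hqabs _ _, fun j => hqlev _, ?_, hed (τ 1), hed (τ 2),
      hed (τ 3), fun i => ?_⟩
    · show sectorIndex n (Complex.arg (⟨q (τ 0) 0, q (τ 0) 1⟩ : ℂ)) = (sh (ed p) s : ℕ)
      rw [hτ0, ← hΩp]
      exact hed p
    · exact (Equiv.sum_comp τ (fun j => q j i)).trans (hGq i)
  -- (2) PIECES: each piece injects, up to the `4³` spin/charge choices of the free legs, into the admissible sharp triples
  have hpiece : ∀ par : (Fin 4 → Fin 2 × Fin 3) × (Fin 5 × Fin 5), ((S par).card : ℝ) ≤ 64 * (Kc * 2 ^ n) := by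
    intro par
    obtain ⟨f, hfdef⟩ : ∃ f : (Fin 4 → SectorLeg (sectorCount n)) → Fin (sectorCount n) × Fin (sectorCount n) × Fin (sectorCount n),
        ∀ Ω, f Ω = (sh (par.1 (τ 1)) (Ω (τ 1)), sh (par.1 (τ 2)) (Ω (τ 2)), sh (par.1 (τ 3)) (Ω (τ 3))) :=
      ⟨_, fun _ => rfl⟩
    have hmaps : ∀ Ω ∈ S par, f Ω ∈ Adm (sh (par.1 p) s) (Gof par.2) := by
      intro Ω hΩ
      rw [hSdef, Finset.mem_filter] at hΩ
      rw [hfdef]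
      exact hΩ.2.2
    have hfib : ∀ b ∈ Adm (sh (par.1 p) s) (Gof par.2), ((S par).filter (fun Ω => f Ω = b)).card ≤ 64 := by
      intro b _
      obtain ⟨sc, hscdef⟩ : ∃ sc : (Fin 4 → SectorLeg (sectorCount n)) → (Fin 2 × Fin 2) × (Fin 2 × Fin 2) × (Fin 2 × Fin 2),
          ∀ Ω, sc Ω = (((Ω (τ 1)).1.2, (Ω (τ 1)).2), ((Ω (τ 2)).1.2, (Ω (τ 2)).2), ((Ω (τ 3)).1.2, (Ω (τ 3)).2)) :=
        ⟨_, fun _ => rfl⟩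
      have hinj : Set.InjOn sc ↑((S par).filter (fun Ω => f Ω = b)) := by
        intro Ω hΩ Ω' hΩ' hsc
        rw [Finset.coe_filter, Set.mem_setOf_eq] at hΩ hΩ'
        have hΩS := hΩ.1
        have hΩ'S := hΩ'.1
        rw [hSdef, Finset.mem_filter] at hΩS hΩ'S
        have hff : f Ω = f Ω' := hΩ.2.trans hΩ'.2.symm
        rw [hfdef, hfdef, Prod.mk.injEq, Prod.mk.injEq] at hff
        rw [hscdef, hscdef, Prod.mk.injEq, Prod.mk.injEq, Prod.mk.injEq, Prod.mk.injEq, Prod.mk.injEq] at hsc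
        have h4 : ∀ m : Fin 4, Ω (τ m) = Ω' (τ m) := by
          intro m
          fin_cases m
          · show Ω (τ 0) = Ω' (τ 0)
            rw [hτ0, hΩS.2.1, hΩ'S.2.1]
          · exact hsh_inj _ _ _ hff.1 hsc.1.1 hsc.1.2
          · exact hsh_inj _ _ _ hff.2.1 hsc.2.1.1 hsc.2.1.2
          · exact hsh_inj _ _ _ hff.2.2 hsc.2.2.1 hsc.2.2.2
        funext i
        rw [← hττ i]
        exact h4 (τ i)
      calc ((S par).filter (fun Ω => f Ω = b)).card
          ≤ (Finset.univ : Finset ((Fin 2 × Fin 2) × (Fin 2 × Fin 2) × (Fin 2 × Fin 2))).card :=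
            Finset.card_le_card_of_injOn sc (fun _ _ => Finset.mem_coe.2 (Finset.mem_univ _)) hinj
        _ = 64 := by simp
    have hle := Finset.card_le_mul_card_image_of_maps_to hmaps 64 hfib
    calc ((S par).card : ℝ) ≤ ((64 * (Adm (sh (par.1 p) s) (Gof par.2)).card : ℕ) : ℝ) := by exact_mod_cast hle
      _ = 64 * ((Adm (sh (par.1 p) s) (Gof par.2)).card : ℝ) := by push_cast; ring
      _ ≤ 64 * (Kc * 2 ^ n) := mul_le_mul_of_nonneg_left (hAdm _ _) (by norm_num)
  -- (3) ASSEMBLY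
  have hsc2 : (2 : ℝ) ^ n ≤ ((sectorCount n : ℕ) : ℝ) := by
    rw [sectorCount]
    push_cast
    rw [pow_succ]
    linarith [pow_pos (by norm_num : (0 : ℝ) < 2) n]
  have hKN : 32400 * (64 * (Kc * (2 : ℝ) ^ n)) ≤ 32400 * 64 * Kc * ((sectorCount n : ℕ) : ℝ) := by
    have := mul_le_mul_of_nonneg_left hsc2 (by positivity : (0 : ℝ) ≤ 32400 * 64 * Kc)
    calc 32400 * (64 * (Kc * (2 : ℝ) ^ n)) = 32400 * 64 * Kc * 2 ^ n := by ring
      _ ≤ 32400 * 64 * Kc * ((sectorCount n : ℕ) : ℝ) := this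
  calc _ ≤ ((Finset.univ.biUnion S).card : ℝ) := by exact_mod_cast Finset.card_le_card hcover
    _ ≤ ∑ par, ((S par).card : ℝ) := by exact_mod_cast Finset.card_biUnion_le
    _ ≤ ∑ _par : (Fin 4 → Fin 2 × Fin 3) × (Fin 5 × Fin 5), 64 * (Kc * 2 ^ n) := Finset.sum_le_sum fun par _ => hpiece par
    _ = 32400 * (64 * (Kc * 2 ^ n)) := by
        simp only [Finset.sum_const, Finset.card_univ, Fintype.card_prod, Fintype.card_fun, Fintype.card_fin, nsmul_eq_mul]
        norm_num
    _ ≤ 32400 * 64 * Kc * ((sectorCount n : ℕ) : ℝ) := hKN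

end Summit.HubbardSuperconductivity.HubbardSuperconductivity.Theorems.PerturbedFermiCurve

end
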